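import Literature.AlgebraicGeometry.Motives.ChernClassesProofs
import Literature.AlgebraicGeometry.Modules.RankOneCocycle
import HarnessLib

/-!
# Finite affine trivialising covers of locally free modules of constant rank on quasi-compact schemes

For a quasi-compact scheme `X` and an `𝒪_X`-module `M` of constant rank `r` (`HasRank M r`: locally free of rank
`r` on an open cover), there are FINITELY many AFFINE opens `V_a` covering `X` with frames `𝒪^r ≅ M|_{V_a}`
(`exists_finite_affine_frame_cover`, frames indexed by `Fin r`; `exists_finite_affine_trivialising_cover`, the
rank-one case with frames indexed by `PUnit`).  Proof: refine the point-indexed frame system of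
★ `Literature.AlgebraicGeometry.Modules.exists_frameSystem_of_hasRank` by affine opens (Mathlib
`Scheme.isBasis_affineOpens`), restrict the frames (★ `SheafOfModules.restrictTrivialisation`), re-index the frames
along `I_x ≃ Fin r` (Mathlib `SheafOfModules.freeFunctor`), and extract a finite subcover (`isCompact_univ`).
Theorems only; no definition, no named fact.  Used by the cell `hodgecm-mathlib`'s M13 node N3 (frames of the
restricted line bundles on the Artinian levels start from such a cover of the abelian variety `A₀`).

## References
* R. Hartshorne, *Algebraic Geometry*, GTM 52 (1977), II §5 (locally free sheaves, p. 109) and Ex. II.5.16. [Hartshorne1977]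
* U. Görtz, T. Wedhorn, *Algebraic Geometry I* (2nd ed. 2020), (11.6) and Prop. 11.15. [GortzWedhorn2020]
-/

noncomputable section

universe u

open CategoryTheory AlgebraicGeometry TopologicalSpace

namespace Literature.AlgebraicGeometry.Modules

open Literature.AlgebraicGeometry.Motives

/-- **A module of constant rank `r` on a quasi-compact scheme has a finite cover by affine opens carrying frames
`𝒪^r ≅ M|_{V_a}`** (indexed by `Fin r`). [cite: Hartshorne1977, II §5 (p. 109) and Ex. II.5.16] -/
theorem exists_finite_affine_frame_cover (X : Scheme.{u}) [CompactSpace X] (M : X.Modules) {r : ℕ}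
    (hM : HasRank M r) :
    ∃ (ι : Type u) (_ : Finite ι) (V : ι → X.Opens), (∀ a, IsAffineOpen (V a)) ∧ iSup V = ⊤ ∧
      ∀ a, Nonempty (SheafOfModules.free (ULift.{u} (Fin r)) ≅ M.over (V a)) := by
  obtain ⟨F, hF⟩ := exists_frameSystem_of_hasRank hM
  have hV : ∀ x : X, ∃ V : X.Opens, IsAffineOpen V ∧ x ∈ V ∧ V ≤ F.U x := fun x => by
    obtain ⟨_, ⟨V, hV, rfl⟩, hxV, hVU⟩ :=
      X.isBasis_affineOpens.exists_subset_of_mem_open (F.mem x) (F.U x).isOpen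
    exact ⟨V, hV, hxV, hVU⟩
  choose V hVaff hxV hVU using hV
  obtain ⟨s, hs⟩ := isCompact_univ.elim_finite_subcover (fun x => (V x : Set X)) (fun x => (V x).isOpen)
    (fun x _ => Set.mem_iUnion.2 ⟨x, hxV x⟩)
  refine ⟨↥s, inferInstance, fun i => V i.1, fun i => hVaff i.1, ?_, fun i => ?_⟩
  · refine top_le_iff.1 fun x _ => ?_
    have hx := hs (Set.mem_univ x)
    rw [Set.mem_iUnion₂] at hx
    obtain ⟨y, hy, hxy⟩ := hx
    exact Opens.mem_iSup.2 ⟨⟨y, hy⟩, hxy⟩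
  · let e : F.I i.1 ≃ ULift.{u} (Fin r) :=
      ((F.enum i.1).trans (finCongr (hF i.1))).trans Equiv.ulift.symm
    have hr : SheafOfModules.free (F.I i.1) ≅ M.over (V i.1) :=
      SheafOfModules.restrictTrivialisation (R := X.ringCatSheaf) (homOfLE (hVU i.1)) (F.frame i.1)
    exact ⟨((SheafOfModules.freeFunctor).mapIso e.toIso).symm ≪≫ hr⟩

/-- **A rank-one module on a quasi-compact scheme has a finite cover by affine opens carrying frames
`𝒪 ≅ M|_{V_a}`** (indexed by `PUnit`). [cite: Hartshorne1977, II §5 (p. 109) and Ex. II.5.16] -/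
theorem exists_finite_affine_trivialising_cover (X : Scheme.{u}) [CompactSpace X] (M : X.Modules)
    (hM : HasRank M 1) :
    ∃ (ι : Type u) (_ : Finite ι) (V : ι → X.Opens), (∀ a, IsAffineOpen (V a)) ∧ iSup V = ⊤ ∧
      ∀ a, Nonempty (SheafOfModules.free (PUnit : Type u) ≅ M.over (V a)) := by
  obtain ⟨ι, hι, V, hVaff, hcov, hfr⟩ := exists_finite_affine_frame_cover X M hM
  refine ⟨ι, hι, V, hVaff, hcov, fun a => ?_⟩
  obtain ⟨e⟩ := hfr a
  let j : ULift.{u} (Fin 1) ≃ (PUnit : Type u) := Equiv.ofUnique _ _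
  exact ⟨((SheafOfModules.freeFunctor).mapIso j.toIso).symm ≪≫ e⟩

end Literature.AlgebraicGeometry.Modules
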